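import Summits.QuantumFields.YangMills.Theorems.SwapVirialDeficitBlowUpGnomonicLetterFloors
import HarnessLib

/-!
# THE GLOBAL FLOOR OF THE CAPPED B-TUBE and its FAR FLOOR — the `hfar` socket of w2 g59's ✓`bTube_fibred_scaled_cylinder_uniform` on LEAD sfw-p2 g99's
# `BTubeCap L τ X₁ = BTube L τ ∩ {x₀² ≤ X₁²(1+|u|²)}` (ruling 2026-08-31 20:48Z: the uncapped tube contains the approach `x₀ → ∞` to stratum A, where NO far
# floor holds; free-hands support of ⟨stmt-QuantumFields-24197⟩ `SwapVirialDeficit.SwapGluedStiffness`, stub `stub_B_stiff` of skeleton ➎)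

At the hub `hubAt δ 1 = (δ, 1, 0, 0)` (w2's hub-cot letters; `|δ| ≤ 1` on the tube's seam window), on `|u|² = x₁² + x₂² ≥ τ²` and under the AXIAL CAP
`x₀² ≤ X₁²(1 + |u|²)` the gnomonic letter of `C₀` keeps a uniform angle from the hub axis: `τ²/((1+τ²)(1+X₁²)) ≤ |u|²/(1+|x|²)` (§6 `bfar_cap_angle`), so the
letter floors of ✓`…GnomonicLetterFloors` combine (pure real arithmetic, `bfar_cap_scalar`) into
* ★★★ `bTubeCap_letter_floor (δ τ X₁) (hτ : 0 < τ) (hδ : δ² ≤ 1) (ε) (η) (hu : τ² ≤ |u|²) (hx0 : x₀² ≤ X₁²(1+|u|²)) :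
  θ·(δ² + x₀²/(1+|u|²) + min(|y|²,1) + min(|z|²,1) + min(Σ_f|η_f|²,1)) ≤ 15000·(1+|Fol L|)·L⁶·F̂`, `θ = τ²/((1+τ²)(1+X₁²)²)`, EVERY sign pattern `ε`;
* ★★★ `bTubeCap_far_floor (δ τ X₁ R) … (hR0 : 0 ≤ R) (hR : R ≤ 1) (hfar : R² ≤ δ² + x₀²/(1+|u|²) + |y|² + |z|² + Σ_f|η_f|²) :
  τ²/(15000(1+τ²)(1+X₁²)²(1+|Fol L|)L⁶)·R² ≤ gnoDeficit 0 1 (hubAt δ 1) ε η` — in w2's rescaled B-fibre letters `‖y‖² = δ² + x₀′² + |y|² + |z|² + Σ|η_f|²`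
  (`x₀ = √(1+|u|²)·x₀′`) this is `R ≤ ‖y‖ ⟹ κ ≤ F̂` with the polynomial `κ(τ, X₁, L)·R²` to be threaded through the tail `e^{−bκ}`.

HONEST LABEL: quaternion bookkeeping on landed inequalities; the B-tube law, stubs `stub_B_stiff` ∕ `stub_core_*` ∕ `stub_h001_good`, ⟨24197⟩ ∕ ⟨24194⟩
and every rung are OPEN; own crux ⟨22884⟩ `LargeFieldMassRefinementTail` OPEN (blocked-on ⟨19935⟩); no crux, rung of record or summit is proved; the
Yang–Mills mass gap is NOT proved; no summit is proved by a line.  THEOREMS ONLY (0 `def`, 0 `sorry`), standard axioms.  Width seat ym-line-sfw-p2-w3 g67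
(cell ym-idea-1, free hands), `--supports stmt-QuantumFields-24197`.  References: [cite: Luscher1983, §2]; [cite: tHooft1979]; [folklore].
-/

set_option autoImplicit false

noncomputable section

open MeasureTheory Quaternion
open scoped BigOperators Quaternion
open Literature.MathematicalPhysics.QuantumFieldTheory hiding SU2
open Literature.MathematicalPhysics.QuantumLattice
open Literature.Analysis.Calculus (radialUnit radialUnit_def norm_radialUnit)

namespace Summit.QuantumFields.YangMills.Theorems.SwapVirialDeficit.BlowUpRing

open Summit.QuantumFields.YangMills.Theorems.FemtoTransferGap
open Summit.QuantumFields.YangMills.Theorems.FemtoTransferGap.TT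
open Summit.QuantumFields.YangMills.Theorems.FemtoTransferGap.TwoLattice.Flat (fd)
open Summit.QuantumFields.YangMills.Theorems.VirialFluxGap.RingDeficit
open Summit.QuantumFields.YangMills.Theorems.SwapVirialDeficit.SwapRing
open Summit.QuantumFields.YangMills.Theorems.SwapTwistDeficit.ToronLog (axisPoint)
open Summit.QuantumFields.YangMills.Theorems.SwapVirialDeficit.ZeroModeSigma (norm_axisUnit su2Quat_quatToSU2_eq_radialUnit)
open Summit.QuantumFields.YangMills.Theorems.ToronValleyVolume.Lojasiewicz (fd_sq_eq_two_mul)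

variable {L : ℕ} [NeZero L]

/-! ## §6 The CAPPED B-TUBE: hub `hubAt δ 1` (`|δ| ≤ 1`), transverse modulus `|u| ≥ τ`, axial cap `x₀² ≤ X₁²(1+|u|²)` -/

omit [NeZero L] in
/-- `min t 1 ≤ 2·t/(1+t)` for `t ≥ 0`. [folklore] -/
theorem bfar_min_le (t : ℝ) (ht : 0 ≤ t) : min t 1 ≤ 2 * (t / (1 + t)) := by
  have h1 : 0 < 1 + t := by linarith
  rw [mul_div_assoc', le_div_iff₀ h1]
  rcases le_or_gt t 1 with h | h
  · rw [min_eq_left h]; nlinarith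
  · rw [min_eq_right h.le]; nlinarith

omit [NeZero L] in
/-- `min (Σ f) 1 ≤ Σ min (f i) 1` for non-negative `f`. [folklore] -/
theorem bfar_min_sum_le {ι : Type*} (s : Finset ι) (f : ι → ℝ) (hf : ∀ i, 0 ≤ f i) : min (∑ i ∈ s, f i) 1 ≤ ∑ i ∈ s, min (f i) 1 := by
  classical
  induction s using Finset.induction_on with
  | empty => simp
  | @insert j s hj ih =>
    rw [Finset.sum_insert hj, Finset.sum_insert hj]
    have hfj := hf j
    have hs : 0 ≤ ∑ i ∈ s, f i := Finset.sum_nonneg fun i _ => hf i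
    have hms : 0 ≤ ∑ i ∈ s, min (f i) 1 := Finset.sum_nonneg fun i _ => le_min (hf i) zero_le_one
    rcases le_or_gt (f j) 1 with h | h
    · rw [min_eq_left h]
      rcases le_or_gt (∑ i ∈ s, f i) 1 with h' | h'
      · rw [min_eq_left h'] at ih
        exact (min_le_left _ _).trans (by linarith)
      · rw [min_eq_right h'.le] at ih
        exact (min_le_right _ _).trans (by linarith)
    · rw [min_eq_right h.le]
      exact (min_le_right _ _).trans (by linarith)

omit [NeZero L] in
/-- `t ↦ t/(1+t)` is monotone on `t ≥ 0`. [folklore] -/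
theorem bfar_frac_mono {s t : ℝ} (hs : 0 ≤ s) (hst : s ≤ t) : s / (1 + s) ≤ t / (1 + t) := by
  rw [div_le_div_iff₀ (by linarith) (by linarith)]; nlinarith

/-- ★ **THE ANGLE BOUND ON THE CAPPED TUBE**: with `U = x₁² + x₂² ≥ τ²` and `x₀² ≤ X₁²(1+U)`,
`τ²/((1+τ²)(1+X₁²)) ≤ U/(1 + |x|²)` and `x₀²/(1+U) ≤ (1+X₁²)·x₀²/(1+|x|²)` — the gnomonic letter of `C₀` keeps a UNIFORM angle from the hub axis. [folklore] -/
theorem bfar_cap_angle {τ X₁ x₀ U : ℝ} (hτ : 0 < τ) (hU : τ ^ 2 ≤ U) (hx : x₀ ^ 2 ≤ X₁ ^ 2 * (1 + U)) :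
    τ ^ 2 / ((1 + τ ^ 2) * (1 + X₁ ^ 2)) ≤ U / (1 + (x₀ ^ 2 + U)) ∧ x₀ ^ 2 / (1 + U) ≤ (1 + X₁ ^ 2) * (x₀ ^ 2 / (1 + (x₀ ^ 2 + U))) := by
  have hU0 : 0 < U := lt_of_lt_of_le (by positivity) hU
  have hT : 1 + (x₀ ^ 2 + U) ≤ (1 + U) * (1 + X₁ ^ 2) := by nlinarith
  have hTpos : 0 < 1 + (x₀ ^ 2 + U) := by positivity
  constructor
  · calc τ ^ 2 / ((1 + τ ^ 2) * (1 + X₁ ^ 2)) ≤ U / ((1 + U) * (1 + X₁ ^ 2)) := by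
          rw [div_le_div_iff₀ (by positivity) (by positivity)]; nlinarith [sq_nonneg X₁]
      _ ≤ U / (1 + (x₀ ^ 2 + U)) := div_le_div_of_nonneg_left hU0.le hTpos hT
  · rw [mul_div_assoc', div_le_div_iff₀ (by positivity) hTpos]
    nlinarith [sq_nonneg x₀, sq_nonneg X₁]

omit [NeZero L] in
/-- ★ **THE SCALAR HEART OF THE CAPPED-TUBE FLOOR**: from the five letter floors at the hub `(δ, 1, 0, 0)` (read as real inequalities), the angle
hypotheses `τ² ≤ |u|²`, `x₀² ≤ X₁²(1+|u|²)` and `δ² ≤ 1`, the combined floor with `θ = τ²/((1+τ²)(1+X₁²)²)`. [folklore] -/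
theorem bfar_cap_scalar {δ τ X₁ x₀ x₁ x₂ y₀ y₁ y₂ Sz SF Φ M N F : ℝ} (hτ : 0 < τ) (hδ : δ ^ 2 ≤ 1) (hM : 0 < M) (hN : 0 ≤ N) (hF : 0 ≤ F)
    (hSz : 0 ≤ Sz) (hSF : 0 ≤ SF)
    (hu : τ ^ 2 ≤ x₁ ^ 2 + x₂ ^ 2) (hx0 : x₀ ^ 2 ≤ X₁ ^ 2 * (1 + (x₁ ^ 2 + x₂ ^ 2)))
    (fz : Sz / (1 + Sz) ≤ 1800 * M * F)
    (fy : 4 * 1 ^ 2 * (y₁ ^ 2 + y₂ ^ 2) / ((1 + δ ^ 2) * (1 + (y₀ ^ 2 + y₁ ^ 2 + y₂ ^ 2))) ≤ 1800 * M * F)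
    (fyx : 4 * ((x₂ * y₀ - x₀ * y₂) ^ 2 + (x₀ * y₁ - x₁ * y₀) ^ 2) / ((1 + (x₀ ^ 2 + x₁ ^ 2 + x₂ ^ 2)) * (1 + (y₀ ^ 2 + y₁ ^ 2 + y₂ ^ 2))) ≤
      1800 * M * F)
    (fδ : 16 * δ ^ 2 * 1 ^ 2 * (x₁ ^ 2 + x₂ ^ 2) / ((1 + δ ^ 2) ^ 2 * (1 + (x₀ ^ 2 + x₁ ^ 2 + x₂ ^ 2))) ≤ 7200 * M * F)
    (ft : 16 * 1 ^ 2 * x₀ ^ 2 * (x₁ ^ 2 + x₂ ^ 2) / ((1 + δ ^ 2) * (1 + (x₀ ^ 2 + x₁ ^ 2 + x₂ ^ 2)) ^ 2) ≤ 18000 * M * F)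
    (fF : Φ ≤ 1152 * M * N * F) (mF : min SF 1 ≤ 2 * Φ) :
    τ ^ 2 / ((1 + τ ^ 2) * (1 + X₁ ^ 2) ^ 2) *
        (δ ^ 2 + x₀ ^ 2 / (1 + (x₁ ^ 2 + x₂ ^ 2)) + min (y₀ ^ 2 + y₁ ^ 2 + y₂ ^ 2) 1 + min Sz 1 + min SF 1) ≤ 15000 * (1 + N) * M * F := by
  -- the one algebraic identity behind the axial `y`-letter: `y₀²|u|² ≤ 2P + 2x₀²|y⊥|²`
  have hPb : y₀ ^ 2 * (x₁ ^ 2 + x₂ ^ 2) ≤ 2 * ((x₂ * y₀ - x₀ * y₂) ^ 2 + (x₀ * y₁ - x₁ * y₀) ^ 2) + 2 * x₀ ^ 2 * (y₁ ^ 2 + y₂ ^ 2) := by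
    nlinarith only [sq_nonneg (x₂ * y₀ - 2 * x₀ * y₂), sq_nonneg (x₁ * y₀ - 2 * x₀ * y₁)]
  -- abbreviations, made opaque (`clear_value`) so that the arithmetic tactics stay cheap
  set U : ℝ := x₁ ^ 2 + x₂ ^ 2 with hU
  set Q : ℝ := y₁ ^ 2 + y₂ ^ 2 with hQ
  set Sy : ℝ := y₀ ^ 2 + y₁ ^ 2 + y₂ ^ 2 with hSy
  set P : ℝ := (x₂ * y₀ - x₀ * y₂) ^ 2 + (x₀ * y₁ - x₁ * y₀) ^ 2 with hP
  set θ₀ : ℝ := τ ^ 2 / ((1 + τ ^ 2) * (1 + X₁ ^ 2)) with hθ₀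
  have hQ0 : 0 ≤ Q := by rw [hQ]; positivity
  have hSy0 : 0 ≤ Sy := by rw [hSy]; positivity
  have hP0 : 0 ≤ P := by rw [hP]; positivity
  have hθ₀pos : 0 < θ₀ := by rw [hθ₀]; positivity
  have hSyQ : Sy = y₀ ^ 2 + Q := by rw [hSy, hQ]; ring
  have hθeq : τ ^ 2 / ((1 + τ ^ 2) * (1 + X₁ ^ 2) ^ 2) = θ₀ / (1 + X₁ ^ 2) := by rw [hθ₀]; field_simp
  have hθ₀1 : θ₀ ≤ 1 := by
    rw [hθ₀, div_le_one (by positivity)]; nlinarith only [sq_nonneg X₁, mul_nonneg (sq_nonneg τ) (sq_nonneg X₁)]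
  obtain ⟨hθ, hX⟩ := bfar_cap_angle hτ hu hx0
  rw [← hθ₀] at hθ
  clear_value U Q Sy P θ₀
  have hT' : 1 + (x₀ ^ 2 + x₁ ^ 2 + x₂ ^ 2) = 1 + (x₀ ^ 2 + U) := by rw [hU]; ring
  rw [hT'] at fyx fδ ft
  simp only [one_pow, mul_one] at fy fδ ft
  have hU0 : 0 < U := lt_of_lt_of_le (pow_pos hτ 2) hu
  have hU1 : 0 < 1 + U := by linarith only [hU0]
  have hT : 0 < 1 + (x₀ ^ 2 + U) := by nlinarith only [hU0, sq_nonneg x₀]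
  have hY : 0 < 1 + Sy := by linarith only [hSy0]
  have hX1 : 0 < 1 + X₁ ^ 2 := by positivity
  have hd2 : 0 < 1 + δ ^ 2 := by positivity
  have hTne : 1 + (x₀ ^ 2 + U) ≠ 0 := hT.ne'
  have hYne : 1 + Sy ≠ 0 := hY.ne'
  have hU1ne : 1 + U ≠ 0 := hU1.ne'
  have hMF : 0 ≤ M * F := by positivity
  have hMNF : 0 ≤ M * N * F := by positivity
  have hratio2 : x₀ ^ 2 / (1 + (x₀ ^ 2 + U)) ≤ 1 := by rw [div_le_one hT]; linarith only [hU0]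
  have hxT0 : 0 ≤ x₀ ^ 2 / (1 + (x₀ ^ 2 + U)) := div_nonneg (sq_nonneg _) hT.le
  have hUT0 : 0 ≤ U / (1 + (x₀ ^ 2 + U)) := div_nonneg hU0.le hT.le
  have hQY0 : 0 ≤ Q / (1 + Sy) := div_nonneg hQ0 hY.le
  have hyY0 : 0 ≤ y₀ ^ 2 / (1 + Sy) := div_nonneg (sq_nonneg _) hY.le
  -- (δ)
  have gδ : θ₀ * δ ^ 2 ≤ 1800 * M * F := by
    have h1 : 16 * δ ^ 2 * U / ((1 + δ ^ 2) ^ 2 * (1 + (x₀ ^ 2 + U))) = (16 * δ ^ 2 / (1 + δ ^ 2) ^ 2) * (U / (1 + (x₀ ^ 2 + U))) := by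
      field_simp
    rw [h1] at fδ
    have h14 : (1 + δ ^ 2) ^ 2 ≤ 4 := by nlinarith only [hδ, sq_nonneg δ]
    have h2 : 4 * δ ^ 2 ≤ 16 * δ ^ 2 / (1 + δ ^ 2) ^ 2 := by
      rw [le_div_iff₀ (by positivity)]
      have e := mul_le_mul_of_nonneg_left h14 (show (0 : ℝ) ≤ 4 * δ ^ 2 by positivity)
      linarith only [e]
    have h3 : 4 * δ ^ 2 * θ₀ ≤ (16 * δ ^ 2 / (1 + δ ^ 2) ^ 2) * (U / (1 + (x₀ ^ 2 + U))) := mul_le_mul h2 hθ hθ₀pos.le (by positivity)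
    linarith only [fδ, h3]
  -- (x₀)
  have gx : θ₀ / (1 + X₁ ^ 2) * (x₀ ^ 2 / (1 + U)) ≤ 2250 * M * F := by
    have h1 : 16 * x₀ ^ 2 * U / ((1 + δ ^ 2) * (1 + (x₀ ^ 2 + U)) ^ 2) =
        (16 / (1 + δ ^ 2)) * ((x₀ ^ 2 / (1 + (x₀ ^ 2 + U))) * (U / (1 + (x₀ ^ 2 + U)))) := by
      field_simp
    rw [h1] at ft
    have h2 : (8 : ℝ) ≤ 16 / (1 + δ ^ 2) := by rw [le_div_iff₀ hd2]; linarith only [hδ]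
    have h4 : x₀ ^ 2 / (1 + U) / (1 + X₁ ^ 2) ≤ x₀ ^ 2 / (1 + (x₀ ^ 2 + U)) := by
      rw [div_le_iff₀ hX1]
      calc x₀ ^ 2 / (1 + U) ≤ (1 + X₁ ^ 2) * (x₀ ^ 2 / (1 + (x₀ ^ 2 + U))) := hX
        _ = x₀ ^ 2 / (1 + (x₀ ^ 2 + U)) * (1 + X₁ ^ 2) := mul_comm _ _
    have h40 : 0 ≤ x₀ ^ 2 / (1 + U) / (1 + X₁ ^ 2) := div_nonneg (div_nonneg (sq_nonneg _) hU1.le) hX1.le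
    have h5 : (x₀ ^ 2 / (1 + U) / (1 + X₁ ^ 2)) * θ₀ ≤ (x₀ ^ 2 / (1 + (x₀ ^ 2 + U))) * (U / (1 + (x₀ ^ 2 + U))) :=
      mul_le_mul h4 hθ hθ₀pos.le hxT0
    have h6 : 8 * ((x₀ ^ 2 / (1 + U) / (1 + X₁ ^ 2)) * θ₀) ≤ (16 / (1 + δ ^ 2)) * ((x₀ ^ 2 / (1 + (x₀ ^ 2 + U))) * (U / (1 + (x₀ ^ 2 + U)))) :=
      mul_le_mul h2 h5 (mul_nonneg h40 hθ₀pos.le) (by positivity)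
    have h7 : θ₀ / (1 + X₁ ^ 2) * (x₀ ^ 2 / (1 + U)) = (x₀ ^ 2 / (1 + U) / (1 + X₁ ^ 2)) * θ₀ := by ring
    rw [h7]; linarith only [ft, h6]
  -- (y)
  have gQ : 2 * (Q / (1 + Sy)) ≤ 1800 * M * F := by
    have h1 : 4 * Q / ((1 + δ ^ 2) * (1 + Sy)) = (4 / (1 + δ ^ 2)) * (Q / (1 + Sy)) := by field_simp
    rw [h1] at fy
    have h2 : (2 : ℝ) ≤ 4 / (1 + δ ^ 2) := by rw [le_div_iff₀ hd2]; linarith only [hδ]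
    have h3 : 2 * (Q / (1 + Sy)) ≤ (4 / (1 + δ ^ 2)) * (Q / (1 + Sy)) := mul_le_mul_of_nonneg_right h2 hQY0
    linarith only [fy, h3]
  have gy0 : 2 * θ₀ * (y₀ ^ 2 / (1 + Sy)) ≤ 1800 * M * F + 4 * (Q / (1 + Sy)) := by
    have h1 : 2 * θ₀ * (y₀ ^ 2 / (1 + Sy)) ≤ 2 * (U / (1 + (x₀ ^ 2 + U))) * (y₀ ^ 2 / (1 + Sy)) :=
      mul_le_mul_of_nonneg_right (by linarith only [hθ]) hyY0
    have h2 : 2 * (U / (1 + (x₀ ^ 2 + U))) * (y₀ ^ 2 / (1 + Sy)) = 2 * (y₀ ^ 2 * U) / ((1 + (x₀ ^ 2 + U)) * (1 + Sy)) := by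
      field_simp
    have h3 : 2 * (y₀ ^ 2 * U) / ((1 + (x₀ ^ 2 + U)) * (1 + Sy)) ≤ (4 * P + 4 * x₀ ^ 2 * Q) / ((1 + (x₀ ^ 2 + U)) * (1 + Sy)) :=
      div_le_div_of_nonneg_right (by linarith only [hPb]) (mul_pos hT hY).le
    have h4 : (4 * P + 4 * x₀ ^ 2 * Q) / ((1 + (x₀ ^ 2 + U)) * (1 + Sy)) =
        4 * P / ((1 + (x₀ ^ 2 + U)) * (1 + Sy)) + 4 * (x₀ ^ 2 / (1 + (x₀ ^ 2 + U))) * (Q / (1 + Sy)) := by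
      field_simp
    have h5 : 4 * (x₀ ^ 2 / (1 + (x₀ ^ 2 + U))) * (Q / (1 + Sy)) ≤ 4 * 1 * (Q / (1 + Sy)) :=
      mul_le_mul_of_nonneg_right (by linarith only [hratio2]) hQY0
    linarith only [h1, h2, h3, h4, h5, fyx]
  have gy : θ₀ * (Sy / (1 + Sy)) ≤ 3600 * M * F := by
    have hsplit : Sy / (1 + Sy) = y₀ ^ 2 / (1 + Sy) + Q / (1 + Sy) := by rw [← add_div, ← hSyQ]
    rw [hsplit, mul_add]
    have e2 : θ₀ * (Q / (1 + Sy)) ≤ 1 * (Q / (1 + Sy)) := mul_le_mul_of_nonneg_right hθ₀1 hQY0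
    linarith only [gy0, gQ, e2]
  -- (z)
  have gz : θ₀ * (Sz / (1 + Sz)) ≤ 1800 * M * F := by
    have e : θ₀ * (Sz / (1 + Sz)) ≤ 1 * (Sz / (1 + Sz)) := mul_le_mul_of_nonneg_right hθ₀1 (div_nonneg hSz (by linarith only [hSz]))
    linarith only [e, fz]
  -- `min` conversions
  have my : min Sy 1 ≤ 2 * (Sy / (1 + Sy)) := bfar_min_le Sy hSy0
  have mz : min Sz 1 ≤ 2 * (Sz / (1 + Sz)) := bfar_min_le Sz hSz
  have mF0 : 0 ≤ min SF 1 := le_min hSF zero_le_one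
  have my0 : 0 ≤ min Sy 1 := le_min hSy0 zero_le_one
  have mz0 : 0 ≤ min Sz 1 := le_min hSz zero_le_one
  -- assemble with `θ = θ₀/(1+X₁²) ≤ θ₀ ≤ 1`
  have hθle : θ₀ / (1 + X₁ ^ 2) ≤ θ₀ := div_le_self hθ₀pos.le (by nlinarith only [sq_nonneg X₁])
  have hθpos : 0 ≤ θ₀ / (1 + X₁ ^ 2) := div_nonneg hθ₀pos.le hX1.le
  rw [hθeq]
  have t1 : θ₀ / (1 + X₁ ^ 2) * δ ^ 2 ≤ 1800 * M * F := (mul_le_mul_of_nonneg_right hθle (sq_nonneg δ)).trans gδ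
  have t3 : θ₀ / (1 + X₁ ^ 2) * min Sy 1 ≤ 7200 * M * F := by
    have e : θ₀ / (1 + X₁ ^ 2) * min Sy 1 ≤ θ₀ * (2 * (Sy / (1 + Sy))) := mul_le_mul hθle my my0 hθ₀pos.le
    linarith only [e, gy]
  have t4 : θ₀ / (1 + X₁ ^ 2) * min Sz 1 ≤ 3600 * M * F := by
    have e : θ₀ / (1 + X₁ ^ 2) * min Sz 1 ≤ θ₀ * (2 * (Sz / (1 + Sz))) := mul_le_mul hθle mz mz0 hθ₀pos.le
    linarith only [e, gz]
  have t5 : θ₀ / (1 + X₁ ^ 2) * min SF 1 ≤ 2304 * M * N * F := by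
    have e : θ₀ / (1 + X₁ ^ 2) * min SF 1 ≤ 1 * min SF 1 := mul_le_mul_of_nonneg_right (hθle.trans hθ₀1) mF0
    linarith only [e, mF, fF]
  have e : θ₀ / (1 + X₁ ^ 2) * (δ ^ 2 + x₀ ^ 2 / (1 + U) + min Sy 1 + min Sz 1 + min SF 1) =
      θ₀ / (1 + X₁ ^ 2) * δ ^ 2 + θ₀ / (1 + X₁ ^ 2) * (x₀ ^ 2 / (1 + U)) + θ₀ / (1 + X₁ ^ 2) * min Sy 1 +
        θ₀ / (1 + X₁ ^ 2) * min Sz 1 + θ₀ / (1 + X₁ ^ 2) * min SF 1 := by ring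
  rw [e]
  nlinarith only [t1, gx, t3, t4, t5, hMF, hMNF]

/-- ★★★ **THE CAPPED B-TUBE LETTER FLOOR** (sector `000`, principal chart, hub `hubAt δ 1` with `δ² ≤ 1`, EVERY sign pattern): on `|u|² = x₁² + x₂² ≥ τ²`,
`x₀² ≤ X₁²(1+|u|²)` (the axial cap of LEAD g99's `BTubeCap`), with `θ = τ²/((1+τ²)(1+X₁²)²)`,
`θ·(δ² + x₀²/(1+|u|²) + min(|y|²,1) + min(|z|²,1) + min(Σ_f|η_f|²,1)) ≤ 15000·(1 + |Fol L|)·L⁶·F̂`. [cite: Luscher1983, §2] [cite: tHooft1979] -/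
theorem bTubeCap_letter_floor (δ τ X₁ : ℝ) (hτ : 0 < τ) (hδ : δ ^ 2 ≤ 1) (ε : GnoSign L) (η : GnoCoord L)
    (hu : τ ^ 2 ≤ (η.1.1 1) ^ 2 + (η.1.1 2) ^ 2) (hx0 : (η.1.1 0) ^ 2 ≤ X₁ ^ 2 * (1 + ((η.1.1 1) ^ 2 + (η.1.1 2) ^ 2))) :
    τ ^ 2 / ((1 + τ ^ 2) * (1 + X₁ ^ 2) ^ 2) *
        (δ ^ 2 + (η.1.1 0) ^ 2 / (1 + ((η.1.1 1) ^ 2 + (η.1.1 2) ^ 2)) + min ((η.1.2 0) ^ 2 + (η.1.2 1) ^ 2 + (η.1.2 2) ^ 2) 1 +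
          min ((η.2.1 0) ^ 2 + (η.2.1 1) ^ 2 + (η.2.1 2) ^ 2) 1 + min (∑ i : Fol L, ((η.2.2 i 0) ^ 2 + (η.2.2 i 1) ^ 2 + (η.2.2 i 2) ^ 2)) 1) ≤
      15000 * (1 + (Fintype.card (Fol L) : ℝ)) * (L : ℝ) ^ 6 * gnoDeficit (fun _ => false) (fun _ => 1) (hubAt δ 1) ε η := by
  have ha : hubAt δ 1 ≠ 0 := hubAt_one_ne_zero δ
  obtain ⟨-, hre, -, hn2⟩ := bfar_hubAt_facts δ
  have him : ‖(hubAt δ 1).im‖ = 1 := norm_im_hubAt_one δ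
  have hL : (0 : ℝ) < L := by exact_mod_cast NeZero.pos L
  have fz := gnoDeficit_floor_z (L := L) ha ε η
  have fy := gnoDeficit_floor_yPerp (L := L) ha ε η
  have fyx := gnoDeficit_floor_yAxial (L := L) (hubAt δ 1) ε η
  have fδ := gnoDeficit_floor_hubPolar (L := L) ha ε η
  have ft := gnoDeficit_floor_tilt (L := L) ha ε η
  have fF := gnoDeficit_floor_followers (L := L) (hubAt δ 1) ε η
  rw [him, hn2, hre] at fδ
  rw [him, hn2] at fy ft
  have mF := (bfar_min_sum_le Finset.univ (fun i : Fol L => (η.2.2 i 0) ^ 2 + (η.2.2 i 1) ^ 2 + (η.2.2 i 2) ^ 2) fun i => by positivity).trans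
    (Finset.sum_le_sum fun i _ => bfar_min_le ((η.2.2 i 0) ^ 2 + (η.2.2 i 1) ^ 2 + (η.2.2 i 2) ^ 2) (by positivity))
  rw [← Finset.mul_sum] at mF
  have h := bfar_cap_scalar (N := (Fintype.card (Fol L) : ℝ)) hτ hδ (pow_pos hL 6) (by positivity) (gnoDeficit_nonneg _ _ _ _ _)
    (by positivity) (Finset.sum_nonneg fun i _ => by positivity) hu hx0
    fz fy fyx fδ ft fF mF
  exact h

omit [NeZero L] in
/-- `r ≤ 1`, `r ≤ A + s₁ + s₂ + s₃` (all non-negative) `⟹ r ≤ A + min s₁ 1 + min s₂ 1 + min s₃ 1`. [folklore] -/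
theorem bfar_le_mins {r A s₁ s₂ s₃ : ℝ} (hr : r ≤ 1) (hA : 0 ≤ A) (h₁ : 0 ≤ s₁) (h₂ : 0 ≤ s₂) (h₃ : 0 ≤ s₃) (h : r ≤ A + s₁ + s₂ + s₃) :
    r ≤ A + min s₁ 1 + min s₂ 1 + min s₃ 1 := by
  have m₁ : 0 ≤ min s₁ 1 := le_min h₁ zero_le_one
  have m₂ : 0 ≤ min s₂ 1 := le_min h₂ zero_le_one
  have m₃ : 0 ≤ min s₃ 1 := le_min h₃ zero_le_one
  rcases le_or_gt s₁ 1 with k₁ | k₁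
  · rcases le_or_gt s₂ 1 with k₂ | k₂
    · rcases le_or_gt s₃ 1 with k₃ | k₃
      · rw [min_eq_left k₁, min_eq_left k₂, min_eq_left k₃]; exact h
      · rw [min_eq_right k₃.le]; linarith
    · rw [min_eq_right k₂.le]; linarith
  · rw [min_eq_right k₁.le]; linarith

/-- ★★★ **THE FAR FLOOR OF THE CAPPED B-TUBE** — the `hfar` socket of w2 g59's ✓`bTube_fibred_scaled_cylinder_uniform` on LEAD g99's `BTubeCap`
(ruling 2026-08-31 20:48Z): at the hub `hubAt δ 1` with `δ² ≤ 1`, on `x₁² + x₂² ≥ τ²`, `x₀² ≤ X₁²(1 + x₁² + x₂²)`, for EVERY sign pattern and every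
`0 ≤ R ≤ 1`: if the rescaled B-fibre displacement is at least `R`, i.e. `R² ≤ δ² + x₀²/(1+|u|²) + |y|² + |z|² + Σ_f |η_f|²`, then
`Λ·R² ≤ F̂` with `Λ = τ²/(15000·(1+τ²)(1+X₁²)²(1+|Fol L|)·L⁶)`. [cite: Luscher1983, §2] [cite: tHooft1979] -/
theorem bTubeCap_far_floor (δ τ X₁ R : ℝ) (hτ : 0 < τ) (hδ : δ ^ 2 ≤ 1) (hR0 : 0 ≤ R) (hR : R ≤ 1) (ε : GnoSign L) (η : GnoCoord L)
    (hu : τ ^ 2 ≤ (η.1.1 1) ^ 2 + (η.1.1 2) ^ 2) (hx0 : (η.1.1 0) ^ 2 ≤ X₁ ^ 2 * (1 + ((η.1.1 1) ^ 2 + (η.1.1 2) ^ 2)))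
    (hfar : R ^ 2 ≤ δ ^ 2 + (η.1.1 0) ^ 2 / (1 + ((η.1.1 1) ^ 2 + (η.1.1 2) ^ 2)) + ((η.1.2 0) ^ 2 + (η.1.2 1) ^ 2 + (η.1.2 2) ^ 2) +
      ((η.2.1 0) ^ 2 + (η.2.1 1) ^ 2 + (η.2.1 2) ^ 2) + ∑ i : Fol L, ((η.2.2 i 0) ^ 2 + (η.2.2 i 1) ^ 2 + (η.2.2 i 2) ^ 2)) :
    τ ^ 2 / (15000 * (1 + τ ^ 2) * (1 + X₁ ^ 2) ^ 2 * (1 + (Fintype.card (Fol L) : ℝ)) * (L : ℝ) ^ 6) * R ^ 2 ≤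
      gnoDeficit (fun _ => false) (fun _ => 1) (hubAt δ 1) ε η := by
  have h := bTubeCap_letter_floor (L := L) δ τ X₁ hτ hδ ε η hu hx0
  have hL : (0 : ℝ) < L := by exact_mod_cast NeZero.pos L
  have hR2 : R ^ 2 ≤ 1 := by nlinarith
  have hmin := bfar_le_mins hR2 (by positivity) (by positivity) (by positivity) (Finset.sum_nonneg fun i _ => by positivity) hfar
  have hθ0 : 0 ≤ τ ^ 2 / ((1 + τ ^ 2) * (1 + X₁ ^ 2) ^ 2) := by positivity
  have hden : 0 < 15000 * (1 + (Fintype.card (Fol L) : ℝ)) * (L : ℝ) ^ 6 := by positivity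
  have key := (mul_le_mul_of_nonneg_left hmin hθ0).trans h
  have e : τ ^ 2 / (15000 * (1 + τ ^ 2) * (1 + X₁ ^ 2) ^ 2 * (1 + (Fintype.card (Fol L) : ℝ)) * (L : ℝ) ^ 6) * R ^ 2 =
      (τ ^ 2 / ((1 + τ ^ 2) * (1 + X₁ ^ 2) ^ 2) * R ^ 2) / (15000 * (1 + (Fintype.card (Fol L) : ℝ)) * (L : ℝ) ^ 6) := by
    field_simp
  rw [e, div_le_iff₀ hden]
  linarith

end Summit.QuantumFields.YangMills.Theorems.SwapVirialDeficit.BlowUpRing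

end
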